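import Summits.FinalStateConjecture.FinalStateConjecture.Theses.ZeroEnergyKerrOrBomb
import Literature.Geometry.Lorentzian.KillingModeStability
import Literature.Geometry.Lorentzian.ZeroEnergyRayTrappedModFlow
import Literature.Geometry.Lorentzian.StationaryVacuumModuliTopology
import Literature.Geometry.Lorentzian.SelfSimilarUnstableMode

/-!
# Sketch — first lemmas of three crux ideas for `StationaryLimitReduction`
(crux item stmt-FinalStateConjecture-10021 = `KerrOrBomb → FinalStateConjecture`, route ZeroEnergyKerrOrBomb)

* Card A `symplectic-dual-of-the-bomb`: chart-level symplectic current of linearised vacuum gravity,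
  its slice pairing, (A1) conservation, (A2) Moncrief orthogonality (ω-orthogonal to every spatially
  compact linearised solution ⇒ pure gauge), (A3) excitation of a non-gauge growing Killing mode by
  spatially compact data.
* Card B `bombs-are-open-kerr-is-isolated`: (B1) growing Killing modes persist under the tree's pointed
  Cheeger–Gromov convergence `StationaryAFBlackHole.ConvergesTo` (bomb locus open in 𝔐);
  (B2) the no-hesitation dichotomy for connected sets of classes.
* Card C `drain-the-ergoregion` (transfer): (C1) no zero-energy null ray trapped modulo the flow ⇒
  Killing-mode-stable; (C2) with `KerrOrBomb` this is optical rigidity (proved composition).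
Stubs are `sorry`; only elaboration is claimed.
-/

noncomputable section

set_option maxSynthPendingDepth 3
set_option linter.dupNamespace false

open Literature.Geometry.Lorentzian
open scoped Manifold ContDiff Topology BigOperators
open Filter Set

namespace Summit.FinalStateConjecture.FinalStateConjecture.Cruxes.StationaryLimitReduction.Sketch

/-! ## Card A — the symplectic dual of the bomb -/

section CardA

variable (Z : E4 → E4 →L[ℝ] E4 →L[ℝ] ℝ)

/-- Inverse-metric components `Z^{μν}(x)` read through `MetricCoord.sharpAt`. -/
def ginv (x : E4) (μ ν : Fin 4) : ℝ :=
  (MetricCoord.sharpAt Z x (EuclideanSpace.proj μ : E4 →L[ℝ] ℝ)) ν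

/-- Coordinate covariant derivative of a field of bilinear forms:
`(∇_d h)(e, f) = D h_x(d)(e, f) − h_x(Γ(d, e), f) − h_x(e, Γ(d, f))`. -/
def covD (h : E4 → E4 →L[ℝ] E4 →L[ℝ] ℝ) (x d e f : E4) : ℝ :=
  fderiv ℝ h x d e f - h x (MetricCoord.chrAt Z x d e) f - h x e (MetricCoord.chrAt Z x d f)

/-- The Burnett–Wald / Hollands–Wald tensor `P^{abcdef} = g^{ae}g^{fb}g^{cd} − ½ g^{ad}g^{be}g^{fc}
− ½ g^{ab}g^{cd}g^{ef} − ½ g^{bc}g^{ae}g^{fd} + ½ g^{bc}g^{ad}g^{ef}` in coordinates. -/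
def symplecticP (x : E4) (a b c d e f : Fin 4) : ℝ :=
  ginv Z x a e * ginv Z x f b * ginv Z x c d - ginv Z x a d * ginv Z x b e * ginv Z x f c / 2
    - ginv Z x a b * ginv Z x c d * ginv Z x e f / 2 - ginv Z x b c * ginv Z x a e * ginv Z x f d / 2
    + ginv Z x b c * ginv Z x a d * ginv Z x e f / 2

/-- Coordinate density `√|det Z_{μν}(x)|`. -/
def dens (x : E4) : ℝ :=
  Real.sqrt |(Matrix.of fun μ ν : Fin 4 ↦ Z x (E4.basisVector μ) (E4.basisVector ν)).det|

/-- The **symplectic current density** of two linearised perturbations,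
`𝔍^a(h₁, h₂) = √|g| P^{abcdef} (h₂_{bc} ∇_d h₁_{ef} − h₁_{bc} ∇_d h₂_{ef})` (Burnett–Wald 1990;
Hollands–Wald, CMP 321 (2013), eq. (43)). -/
def symplecticCurrent (h₁ h₂ : E4 → E4 →L[ℝ] E4 →L[ℝ] ℝ) (x : E4) (a : Fin 4) : ℝ :=
  dens Z x * ∑ b : Fin 4, ∑ c : Fin 4, ∑ d : Fin 4, ∑ e : Fin 4, ∑ f : Fin 4,
    symplecticP Z x a b c d e f *
      (h₂ x (E4.basisVector b) (E4.basisVector c) *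
          covD Z h₁ x (E4.basisVector d) (E4.basisVector e) (E4.basisVector f) -
        h₁ x (E4.basisVector b) (E4.basisVector c) *
          covD Z h₂ x (E4.basisVector d) (E4.basisVector e) (E4.basisVector f))

/-- The **slice pairing** `ω_τ(h₁, h₂) = ∫_{t = τ} 𝔍^0 d³y`. -/
def slicePairing (h₁ h₂ : E4 → E4 →L[ℝ] E4 →L[ℝ] ℝ) (τ : ℝ) : ℝ :=
  ∫ y : E3, symplecticCurrent Z h₁ h₂ (E4.ofTimeSpace τ y) 0

/-- A **spatially compact linearised vacuum solution on the slab `{τ₁ ≤ t ≤ τ₂} ∩ U`**: symmetric,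
smooth, `Ric'_Z(k) = 0`, vanishing outside the tube over a compact spatial set. -/
def IsCompactLinearisedSolution (U : Set E4) (τ₁ τ₂ : ℝ) (k : E4 → E4 →L[ℝ] E4 →L[ℝ] ℝ) : Prop :=
  ContDiffOn ℝ ⊤ k U ∧ (∀ x ∈ U, ∀ v w : E4, k x v w = k x w v) ∧
    (∀ x ∈ U, τ₁ ≤ E4.time x → E4.time x ≤ τ₂ → MetricCoord.linRicAt Z k x = 0) ∧
    ∃ K : Set E3, IsCompact K ∧ ∀ x ∈ U, τ₁ ≤ E4.time x → E4.time x ≤ τ₂ →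
      E4.spatial x ∉ K → k x = 0

/-- **(A1) Conservation of the symplectic current** (sketch): on a vacuum chart background the slice
pairing of two linearised solutions, one of them spatially compact in the slab, is the same on the two
faces of the slab. -/
theorem slicePairing_eq_of_linearised (U : Set E4) (hZ : MetricCoord.IsMetricOn Z U)
    (hvac : ∀ x ∈ U, MetricCoord.ricAt Z x = 0) (τ₁ τ₂ : ℝ)
    (hslab : ∀ x : E4, τ₁ ≤ E4.time x → E4.time x ≤ τ₂ → x ∈ U)
    (h k : E4 → E4 →L[ℝ] E4 →L[ℝ] ℝ) (hh : ContDiffOn ℝ ⊤ h U)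
    (hhs : ∀ x ∈ U, ∀ v w : E4, h x v w = h x w v)
    (hhl : ∀ x ∈ U, MetricCoord.linRicAt Z h x = 0)
    (hk : IsCompactLinearisedSolution Z U τ₁ τ₂ k) :
    slicePairing Z h k τ₁ = slicePairing Z h k τ₂ := by
  sorry

/-- **(A2) Moncrief orthogonality** (sketch; Moncrief, J. Math. Phys. 16 (1975) 493; Fischer–Marsden):
a linearised solution `H` whose slice pairing with EVERY spatially compact linearised solution of the
slab vanishes is pure gauge on the open slab. -/
theorem isPureGauge_of_slicePairing_eq_zero (U : Set E4) (hZ : MetricCoord.IsMetricOn Z U)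
    (hvac : ∀ x ∈ U, MetricCoord.ricAt Z x = 0)
    (hslab : ∀ x : E4, -1 ≤ E4.time x → E4.time x ≤ 1 → x ∈ U)
    (H : E4 → E4 →L[ℝ] E4 →L[ℝ] ℝ) (hH : ContDiffOn ℝ ⊤ H U)
    (hHs : ∀ x ∈ U, ∀ v w : E4, H x v w = H x w v)
    (hHl : ∀ x ∈ U, MetricCoord.linRicAt Z H x = 0)
    (horth : ∀ k, IsCompactLinearisedSolution Z U (-1) 1 k → slicePairing Z H k 0 = 0) :
    MetricCoord.IsPureGaugeOn Z {x | -1 < E4.time x ∧ E4.time x < 1} H := by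
  sorry

/-- A **growing Killing-mode pair of linearised vacuum gravity** on a stationary chart background
(`Z(x + t e₀) = Z(x)`): `(h₁, h₂)` symmetric and smooth on `U`, `Ric'_Z(hᵢ) = 0`,
`∂_{e₀} h₁ = ν h₁ − ϖ h₂`, `∂_{e₀} h₂ = ϖ h₁ + ν h₂` (the Lie derivative along the constant field
`e₀ = ∂_{t*}` is the directional derivative), and not both pure gauge. The tensorial analogue of
`StationaryAFBlackHole.IsKillingModePair`. -/
def IsLinearisedKillingModePair (U : Set E4) (ν ϖ : ℝ) (h₁ h₂ : E4 → E4 →L[ℝ] E4 →L[ℝ] ℝ) : Prop :=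
  ContDiffOn ℝ ⊤ h₁ U ∧ ContDiffOn ℝ ⊤ h₂ U ∧
    (∀ x ∈ U, ∀ v w : E4, h₁ x v w = h₁ x w v) ∧ (∀ x ∈ U, ∀ v w : E4, h₂ x v w = h₂ x w v) ∧
    (∀ x ∈ U, MetricCoord.linRicAt Z h₁ x = 0 ∧ MetricCoord.linRicAt Z h₂ x = 0) ∧
    (∀ x ∈ U, fderiv ℝ h₁ x (E4.basisVector 0) = ν • h₁ x - ϖ • h₂ x ∧
      fderiv ℝ h₂ x (E4.basisVector 0) = ϖ • h₁ x + ν • h₂ x) ∧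
    ¬ (MetricCoord.IsPureGaugeOn Z U h₁ ∧ MetricCoord.IsPureGaugeOn Z U h₂)

/-- **(A3) Spatially compact data see the bomb** (sketch, the consequence of A1 + A2 the genericity
transfer consumes): on a stationary vacuum chart background carrying a non-gauge growing Killing-mode
pair of rate `ν > 0`, some spatially compact linearised solution has non-zero slice pairing with the
mode — its unstable-mode coefficient, conserved in time by (A1), does not vanish. -/
theorem exists_compact_kick_pairing_ne_zero (U : Set E4) (hZ : MetricCoord.IsMetricOn Z U)
    (hvac : ∀ x ∈ U, MetricCoord.ricAt Z x = 0)
    (hstat : ∀ (x : E4) (t : ℝ), Z (x + t • E4.basisVector 0) = Z x)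
    (hU : ∀ x ∈ U, ∀ t : ℝ, x + t • E4.basisVector 0 ∈ U)
    (hslab : ∀ x : E4, -1 ≤ E4.time x → E4.time x ≤ 1 → x ∈ U)
    {ν ϖ : ℝ} (hν : 0 < ν) {h₁ h₂ : E4 → E4 →L[ℝ] E4 →L[ℝ] ℝ}
    (hmode : IsLinearisedKillingModePair Z U ν ϖ h₁ h₂) :
    ∃ k, IsCompactLinearisedSolution Z U (-1) 1 k ∧
      (slicePairing Z h₁ k 0 ≠ 0 ∨ slicePairing Z h₂ k 0 ≠ 0) := by
  sorry

end CardA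

/-! ## Card B — bombs are open, Kerr is isolated -/

section CardB

/-- **(B1) Growing Killing modes persist under pointed Cheeger–Gromov convergence** (sketch): if
regular stationary vacuum holes `𝓑ₙ → 𝓑` in the sense of `StationaryAFBlackHole.ConvergesTo` and
`𝓑` carries a non-trivial growing Killing-mode pair (`¬ IsKillingModeStable`), then so does `𝓑ₙ`
for all large `n` (Kato stability of an isolated eigenvalue `Re s > 0` of the hyperboloidal evolution
generator; Warnick, CMP 333 (2015)): the bomb locus of `𝔐` is open. -/
theorem eventually_not_isKillingModeStable_of_convergesTo
    {𝓑s : ℕ → StationaryAFBlackHole.{0}} {𝓑 : StationaryAFBlackHole.{0}}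
    [∀ n, (𝓑s n).metric.HasLeviCivita] [𝓑.metric.HasLeviCivita]
    (hreg : ∀ n, (𝓑s n).IsRegularVacuum) (hreg₀ : 𝓑.IsRegularVacuum)
    (hconv : StationaryAFBlackHole.ConvergesTo 𝓑s 𝓑)
    (hbomb : ¬ 𝓑.IsKillingModeStable) :
    ∀ᶠ n in atTop, ¬ (𝓑s n).IsKillingModeStable := by
  sorry

/-- **(B2) No hesitation** (proved): a connected set of classes covered by two disjoint open loci lies
in one of them — with `K` = Kerr locus (open by Alexakis–Ionescu–Klainerman perturbative rigidity),
`B` = bomb locus (open by B1) and `Ω` = a late-time ω-limit set (connected), `KerrOrBomb` supplying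
`Ω ⊆ K ∪ B`. -/
theorem subset_or_subset_of_isPreconnected {X : Type*} [TopologicalSpace X] {K B Ω : Set X}
    (hK : IsOpen K) (hB : IsOpen B) (hdisj : Disjoint K B) (hΩ : IsPreconnected Ω)
    (hcover : Ω ⊆ K ∪ B) : Ω ⊆ K ∨ Ω ⊆ B :=
  hΩ.subset_or_subset hK hB hdisj hcover

end CardB

/-! ## Card C — drain the ergoregion (transfer) -/

section CardC

/-- **(C1) Drained ergoregion ⇒ Killing-mode stability** (sketch; the fixed-background linear statement
into which the spin-dependence of the crux is quarantined): a Ricci-flat stationary AF black hole with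
connected non-degenerate horizon, globally hyperbolic carrier and `T ≠ 0` on the d.o.c., NONE of whose
zero-energy null geodesics is trapped modulo the stationary flow, has no growing Killing-mode pair. In
sub-extremal Kerr this is Whiting's theorem read through `KerrNoZeroEnergyTrapping`. -/
def DrainedImpliesModeStable : Prop :=
  ∀ (𝓑 : StationaryAFBlackHole.{0}) [𝓑.metric.HasLeviCivita] [Kerr.Facts],
    𝓑.metric.toPseudoRiemannianMetric.IsRicciFlat → IsConnected 𝓑.horizon →
    𝓑.toSpacetime.IsNonDegenerateHorizon 𝓑.Mext → 𝓑.metric.IsGloballyHyperbolic 𝓑.timeOrientation →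
    (∀ p ∈ 𝓑.doc, 𝓑.killing p ≠ 0) → ¬ 𝓑.HasZeroEnergyRayTrappedModFlow → 𝓑.IsKillingModeStable

/-- **(C2) Optical rigidity from `KerrOrBomb` and (C1)** (proved composition): under `KerrOrBomb`, a
regular stationary vacuum hole with drained ergoregion is a sub-extremal Kerr exterior — the
Alexakis–Ionescu–Klainerman conjecture in the route's fact-free isometric-immersion form. This is the
form of the hypothesis the dynamical half of the transferred crux consumes (only zero-energy OPTICS of
the limit hole has to be certified, which gravitational Gaussian beams see). -/
theorem opticalRigidity_of_kerrOrBomb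
    (hK : Summit.FinalStateConjecture.FinalStateConjecture.Theses.ZeroEnergyKerrOrBomb.KerrOrBomb)
    (hC1 : DrainedImpliesModeStable) (𝓑 : StationaryAFBlackHole.{0}) [𝓑.metric.HasLeviCivita]
    [Kerr.Facts] (hRic : 𝓑.metric.toPseudoRiemannianMetric.IsRicciFlat)
    (hconn : IsConnected 𝓑.horizon) (hnd : 𝓑.toSpacetime.IsNonDegenerateHorizon 𝓑.Mext)
    (hgh : 𝓑.metric.IsGloballyHyperbolic 𝓑.timeOrientation) (hT : ∀ p ∈ 𝓑.doc, 𝓑.killing p ≠ 0)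
    (hΓ : ¬ 𝓑.HasZeroEnergyRayTrappedModFlow) :
    ∃ (M a : ℝ), Kerr.IsSubextremal M a ∧ ∃ Ψ : Kerr.exterior M a → 𝓑.carrier,
      Function.Injective Ψ ∧ Set.range Ψ = 𝓑.doc ∧
        PseudoRiemannianMetric.IsIsometricImmersion
          (Kerr.smoothMetric M a (Kerr.rPlus M a)).toPseudoRiemannianMetric
          𝓑.metric.toPseudoRiemannianMetric Ψ :=
  hK 𝓑 hRic hconn hnd hgh hT
    ((StationaryAFBlackHole.isKillingModeStable_iff 𝓑).1 (hC1 𝓑 hRic hconn hnd hgh hT hΓ))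

/-- **Typed proxy for STABLE trapping**: an open family of trapped null geodesics modulo the flow —
a non-empty open set `V` of the d.o.c. and, at each of its points, a non-empty open set `O` of
tangent vectors such that every maximal NULL geodesic launched from `(x, v)`, `v ∈ O`, stays inside
the `T`-orbit of one compact `S ⊆ d.o.c.` (elliptic / KAM trapping produces such families in the
integrable and near-integrable cases; normally hyperbolic trapping — Kerr's photon region — never
does: its trapped set has empty interior). -/
def HasOpenTrappedNullFamily (𝓑 : StationaryAFBlackHole.{0}) [𝓑.metric.HasLeviCivita] : Prop :=
  ∃ S : Set 𝓑.carrier, IsCompact S ∧ S ⊆ 𝓑.doc ∧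
    ∃ V : Set 𝓑.carrier, IsOpen V ∧ V.Nonempty ∧ V ⊆ 𝓑.doc ∧
      ∀ x ∈ V, ∃ O : Set (TangentSpace (𝓡 4) x), IsOpen O ∧ O.Nonempty ∧
        ∀ (γ : ℝ → 𝓑.carrier) (s : Set ℝ),
          IsMaximalGeodesicOn 𝓑.metric.toPseudoRiemannianMetric.leviCivita γ s → (0 : ℝ) ∈ s →
          γ 0 = x → (velocity (𝓡 4) γ 0 : E4) ∈ (O : Set E4) →
          𝓑.metric.val (γ 0) (velocity (𝓡 4) γ 0) (velocity (𝓡 4) γ 0) = 0 →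
          ∀ t ∈ s, γ t ∈ stationaryOrbit 𝓑.killing S

/-- **(C1\*) Kerr-like optics ⇒ Kerr-like spectrum** (sketch; the corrected quarantine statement):
a Ricci-flat stationary AF black hole with connected non-degenerate horizon, globally hyperbolic
carrier, `T ≠ 0` on the d.o.c. and NO open family of trapped null geodesics modulo the flow (no stable
trapping; normally hyperbolic or empty trapped set) is Killing-mode-stable. High-frequency half:
normally-hyperbolic-trapping resonance gaps in a regular (hyperboloidal, horizon-penetrating) slicing;
bounded-frequency half: "Whiting without separability". -/
def NoStableTrappingImpliesModeStable : Prop :=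
  ∀ (𝓑 : StationaryAFBlackHole.{0}) [𝓑.metric.HasLeviCivita] [Kerr.Facts],
    𝓑.metric.toPseudoRiemannianMetric.IsRicciFlat → IsConnected 𝓑.horizon →
    𝓑.toSpacetime.IsNonDegenerateHorizon 𝓑.Mext → 𝓑.metric.IsGloballyHyperbolic 𝓑.timeOrientation →
    (∀ p ∈ 𝓑.doc, 𝓑.killing p ≠ 0) → ¬ HasOpenTrappedNullFamily 𝓑 → 𝓑.IsKillingModeStable

/-- **(C2\*) Optical rigidity, stable-trapping form** (proved composition): under `KerrOrBomb` and
(C1\*), a regular stationary vacuum hole without stable trapping is a sub-extremal Kerr exterior — the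
hypothesis the transferred dynamical half certifies with spin-2 Gaussian beams. -/
theorem opticalRigidity_of_kerrOrBomb'
    (hK : Summit.FinalStateConjecture.FinalStateConjecture.Theses.ZeroEnergyKerrOrBomb.KerrOrBomb)
    (hC1 : NoStableTrappingImpliesModeStable) (𝓑 : StationaryAFBlackHole.{0}) [𝓑.metric.HasLeviCivita]
    [Kerr.Facts] (hRic : 𝓑.metric.toPseudoRiemannianMetric.IsRicciFlat)
    (hconn : IsConnected 𝓑.horizon) (hnd : 𝓑.toSpacetime.IsNonDegenerateHorizon 𝓑.Mext)
    (hgh : 𝓑.metric.IsGloballyHyperbolic 𝓑.timeOrientation) (hT : ∀ p ∈ 𝓑.doc, 𝓑.killing p ≠ 0)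
    (hΓ : ¬ HasOpenTrappedNullFamily 𝓑) :
    ∃ (M a : ℝ), Kerr.IsSubextremal M a ∧ ∃ Ψ : Kerr.exterior M a → 𝓑.carrier,
      Function.Injective Ψ ∧ Set.range Ψ = 𝓑.doc ∧
        PseudoRiemannianMetric.IsIsometricImmersion
          (Kerr.smoothMetric M a (Kerr.rPlus M a)).toPseudoRiemannianMetric
          𝓑.metric.toPseudoRiemannianMetric Ψ :=
  hK 𝓑 hRic hconn hnd hgh hT
    ((StationaryAFBlackHole.isKillingModeStable_iff 𝓑).1 (hC1 𝓑 hRic hconn hnd hgh hT hΓ))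

end CardC

end Summit.FinalStateConjecture.FinalStateConjecture.Cruxes.StationaryLimitReduction.Sketch

end
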